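import Literature.Probability.LatticeModels.DiagonalTorus
import Literature.Probability.LatticeModels.SharpnessProofs
import HarnessLib

/-!
# The Griffiths sandwich for the diagonally wrapped torus: the cylinder limit is the plus-state diagonal correlation

Topic `Probability/LatticeModels`, namespace `Literature.Probability.LatticeModels`. Sixth file of
the exact computation of the critical diagonal correlations of the planar Ising model behind
`Literature.Probability.LatticeModels.wu_rhoCHI`. With `DiagonalTorus` (the diagonally wrapped
torus `𝕋_{N,L} = ℤ²/⟨(L,0),(-N,N)⟩`, its in-layer two-point function `diagTorusPair β N L n` between
the images of the lattice points `0` and `(-n, n)`, and its limit along the torus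
`tendsto_diagTorusPair`), this file carries out, verbatim along the tree's treatment of rows
(G. Benettin, G. Gallavotti, G. Jona-Lasinio, A. L. Stella, Comm. Math. Phys. **30** (1973) 45, §3,
eqs. (3.6)–(3.7): "introduce additional couplings … afterwards … an infinite magnetic field acting
on the spins of `∂Λ`"; the tree's `OnsagerYang` §BGJS (3.6), `OnsagerYangSandwich`, and
`RotatedTorus` for the rotated volumes), the Griffiths sandwich

  `⟨σ_0σ_x⟩^∅_{Λ_R} ≤ ⟨σ_{π0}σ_{πx}⟩_{𝕋_{N,L}} ≤ ⟨σ_0σ_x⟩⁺_{Λ_R}`,  `x = (-n, n)`, `n ≤ R`, `2R + 4 ≤ N`, `2N ≤ L`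

(`isingCorr_free_box_le_diagTorusPair`, `diagTorusPair_le_isingCorr_plus_box`: the free box of
`ℤ²` is a charted sub-volume of the torus — `diagProj` is injective on `Λ_{R+1}` and respects
adjacency there —, free correlations increase with the volume, plus correlations decrease, GKS II),
and the squeeze: **where the free and plus two-point functions of `ℤ²` agree at `x = (-n, n)`, the
cylinder values `c_N = lim_{M'} ⟨σσ⟩_{𝕋_{N,2NM'}}` converge, as `N → ∞`, to `⟨σ_0σ_{(-n,n)}⟩⁺_β`**
(`tendsto_cyl_of_twoPointFree_eq_twoPointPlus`; BGJS eq. (3.1), "`⟨σ_xσ_y⟩_a = ⟨σ_xσ_y⟩_p =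
⟨σ_xσ_y⟩_+`"). At `β = β_c(2)` the hypothesis holds by the continuity of the magnetisation
(`PlanarIsingCriticalMagnetization`) and the Lebowitz–Martin-Löf criterion (`PlusFreeComparison`),
and `c_N` is the Cauchy-type determinant of `DiagonalCylinderDeterminant` — the assembly is the
final file. Everything is proved; no named fact.

## References

* G. Benettin, G. Gallavotti, G. Jona-Lasinio, A. L. Stella, Comm. Math. Phys. 30 (1973) 45–54, §3.
* S. Friedli, Y. Velenik, *Statistical mechanics of lattice systems* (2017), §3.1, Exercise 3.12.
-/

noncomputable section

open MeasureTheory Filter Topology Finset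

namespace Literature.Probability.LatticeModels

/-! ### Part 1. The Ising model on the diagonal torus: charted boxes and the two Griffiths bounds -/

section Ising

variable {N L : ℕ} [NeZero N] [NeZero L]

variable (N L) in
/-- The two-point function `⟨σ_uσ_v⟩_{𝕋_{N,L};β}` of the (free-on-the-whole-graph) Ising model on the
diagonally wrapped torus. [cite: BenettinGallavottiJonaLasinioStella1973, eq. (3.3) (periodic two-point functions)] -/
def dTwoPoint (β : ℝ) (u v : DiagSite N L) : ℝ :=
  isingTwoPoint (diagGraph N L) Finset.univ β 0 .free u v

/-- **The free box inside the diagonal torus is the free box**: for `x, y ∈ Λ_R`, `2R + 1 < N`,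
`2N ≤ L`, the image of `Λ_R` induces an isomorphic graph. [cite: FriedliVelenik2017, §3.1, Def. 3.1] -/
theorem isingTwoPoint_diag_image_box_eq {β : ℝ} (h : ℝ) {R : ℕ} (hRN : 2 * R + 1 < N) (hL : 2 * N ≤ L) {x y : Site 2}
    (hx : x ∈ box 2 R) (hy : y ∈ box 2 R) :
    isingTwoPoint (diagGraph N L) ((box 2 R).image (diagProj N L)) β h .free (diagProj N L x) (diagProj N L y) =
      isingTwoPoint (zdGraph 2) (box 2 R) β h .free x y := by
  classical
  set S := ↥(box 2 R) with hS
  let ι₁ : S ↪ Site 2 := Function.Embedding.subtype _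
  let Gs : SimpleGraph S := (zdGraph 2).comap ι₁
  have h1 : isingTwoPoint (zdGraph 2) (box 2 R) β h .free x y = isingTwoPoint Gs Finset.univ β h .free ⟨x, hx⟩ ⟨y, hy⟩ := by
    have hmap : (Finset.univ : Finset S).map ι₁ = box 2 R := by
      rw [Finset.univ_eq_attach, Finset.attach_map_val]
    have := isingTwoPoint_free_map (G := Gs) (G' := zdGraph 2) ι₁ (Λ := Finset.univ) (fun a _ b _ => Iff.rfl) β h ⟨x, hx⟩ ⟨y, hy⟩
    rw [hmap] at this
    exact this
  let ι₂ : S ↪ DiagSite N L :=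
    ⟨fun a => diagProj N L a.1, fun a b hab => Subtype.ext (diagProj_injOn_box (by omega) hL a.2 b.2 hab)⟩
  have hadj : ∀ a ∈ (Finset.univ : Finset S), ∀ b ∈ (Finset.univ : Finset S),
      ((diagGraph N L).Adj (ι₂ a) (ι₂ b) ↔ Gs.Adj a b) := fun a _ b _ => diagGraph_adj_proj_iff hRN hL a.2 b.2
  have hmap₂ : (Finset.univ : Finset S).map ι₂ = (box 2 R).image (diagProj N L) := by
    ext u
    simp only [Finset.mem_map, Finset.mem_univ, true_and, Finset.mem_image]
    constructor
    · rintro ⟨a, rfl⟩; exact ⟨a.1, a.2, rfl⟩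
    · rintro ⟨z, hz, rfl⟩; exact ⟨⟨z, hz⟩, rfl⟩
  have h2 : isingTwoPoint Gs Finset.univ β h .free ⟨x, hx⟩ ⟨y, hy⟩ =
      isingTwoPoint (diagGraph N L) (Finset.univ.map ι₂) β h .free (diagProj N L x) (diagProj N L y) :=
    (isingTwoPoint_free_map (G := Gs) (G' := diagGraph N L) ι₂ hadj β h ⟨x, hx⟩ ⟨y, hy⟩).symm
  rw [h1, h2, hmap₂]

/-- **Free box ≤ diagonal torus** (Griffiths II: enlarging the free volume from the image of the box
to the whole torus). For `β ≥ 0`, `x, y ∈ Λ_R`, `2R + 1 < N`, `2N ≤ L`. [cite: BenettinGallavottiJonaLasinioStella1973, eq. (3.6)] -/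
theorem isingTwoPoint_free_box_le_dTwoPoint {β : ℝ} (hβ : 0 ≤ β) {R : ℕ} (hRN : 2 * R + 1 < N) (hL : 2 * N ≤ L)
    {x y : Site 2} (hx : x ∈ box 2 R) (hy : y ∈ box 2 R) :
    isingTwoPoint (zdGraph 2) (box 2 R) β 0 .free x y ≤ dTwoPoint N L β (diagProj N L x) (diagProj N L y) := by
  classical
  rcases eq_or_ne x y with rfl | hxy
  · simp [dTwoPoint]
  have hne : diagProj N L x ≠ diagProj N L y := fun h => hxy (diagProj_injOn_box (by omega) hL hx hy h)
  rw [← isingTwoPoint_diag_image_box_eq 0 hRN hL hx hy, dTwoPoint, isingTwoPoint_eq_isingCorr _ _ _ _ _ hne,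
    isingTwoPoint_eq_isingCorr _ _ _ _ _ hne]
  refine isingCorr_free_le_of_subset (diagGraph N L) hβ le_rfl ?_ (Finset.subset_univ _)
  intro z hz
  simp only [Finset.mem_insert, Finset.mem_singleton] at hz
  rcases hz with rfl | rfl
  · exact Finset.mem_image.2 ⟨x, hx, rfl⟩
  · exact Finset.mem_image.2 ⟨y, hy, rfl⟩

/-- **Diagonal torus ≤ plus box** (freezing to `+1` the spins outside the image of `Λ_R` raises
correlations; the frozen model is the `+` box transported along the embedding of `Λ_{R+1}`). For
`β ≥ 0`, `A ⊆ Λ_R`, `2R + 4 ≤ N`, `2N ≤ L`. [cite: BenettinGallavottiJonaLasinioStella1973, eq. (3.6)] -/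
theorem isingCorr_diag_le_isingCorr_plus_box {β : ℝ} (hβ : 0 ≤ β) {R : ℕ} (hRN : 2 * R + 4 ≤ N) (hL : 2 * N ≤ L)
    {A : Finset (Site 2)} (hA : A ⊆ box 2 R) :
    isingCorr (diagGraph N L) Finset.univ β 0 .free (A.image (diagProj N L)) ≤ isingCorr (zdGraph 2) (box 2 R) β 0 .plus A := by
  classical
  set S := ↥(box 2 (R + 1)) with hS
  let ι₁ : S ↪ Site 2 := Function.Embedding.subtype _
  let Gs : SimpleGraph S := (zdGraph 2).comap ι₁
  let ι₂ : S ↪ DiagSite N L :=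
    ⟨fun a => diagProj N L a.1, fun a b hab => Subtype.ext (diagProj_injOn_box (by omega) hL a.2 b.2 hab)⟩
  have hMM : box 2 R ⊆ box 2 (R + 1) := box_mono 2 (Nat.le_succ R)
  set Λ₀ : Finset S := Finset.univ.filter fun a => (a : Site 2) ∈ box 2 R with hΛ₀
  set A₀ : Finset S := Finset.univ.filter fun a => (a : Site 2) ∈ A with hA₀
  have hΛ₀map : Λ₀.map ι₁ = box 2 R := by
    ext x
    simp only [Finset.mem_map, Finset.mem_filter, Finset.mem_univ, true_and, hΛ₀]
    constructor
    · rintro ⟨a, ha, rfl⟩; exact ha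
    · intro hx; exact ⟨⟨x, hMM hx⟩, hx, rfl⟩
  have hA₀map : A₀.map ι₁ = A := by
    ext x
    simp only [Finset.mem_map, Finset.mem_filter, Finset.mem_univ, true_and, hA₀]
    constructor
    · rintro ⟨a, ha, rfl⟩; exact ha
    · intro hx; exact ⟨⟨x, hMM (hA hx)⟩, hx, rfl⟩
  have hA₀map₂ : A₀.map ι₂ = A.image (diagProj N L) := by
    ext x'
    simp only [Finset.mem_map, Finset.mem_filter, Finset.mem_univ, true_and, hA₀, Finset.mem_image]
    constructor
    · rintro ⟨a, ha, rfl⟩; exact ⟨a, ha, rfl⟩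
    · rintro ⟨x, hx, rfl⟩; exact ⟨⟨x, hMM (hA hx)⟩, hx, rfl⟩
  have hA₀Λ₀ : A₀ ⊆ Λ₀ := by
    intro a ha
    simp only [Finset.mem_filter, Finset.mem_univ, true_and, hA₀, hΛ₀] at ha ⊢
    exact hA ha
  have hadj₁ : ∀ a ∈ Λ₀, ∀ b : S, (zdGraph 2).Adj (ι₁ a) (ι₁ b) ↔ Gs.Adj a b := fun a _ b => Iff.rfl
  have hnb₁ : ∀ a ∈ Λ₀, ∀ y : Site 2, (zdGraph 2).Adj (ι₁ a) y → ∃ b : S, ι₁ b = y := by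
    intro a ha y h
    have ha' : (a : Site 2) ∈ box 2 R := by simpa [hΛ₀] using ha
    exact ⟨⟨y, mem_box_succ_of_zdGraph_adj (d := 2) ha' h⟩, rfl⟩
  have hadj₂ : ∀ a ∈ Λ₀, ∀ b : S, (diagGraph N L).Adj (ι₂ a) (ι₂ b) ↔ Gs.Adj a b := by
    intro a _ b
    exact diagGraph_adj_proj_iff (R := R + 1) (by omega) hL a.2 b.2
  have hnb₂ : ∀ a ∈ Λ₀, ∀ v : DiagSite N L, (diagGraph N L).Adj (ι₂ a) v → ∃ b : S, ι₂ b = v := by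
    intro a ha v h
    have ha' : (a : Site 2) ∈ box 2 R := by simpa [hΛ₀] using ha
    obtain ⟨-, y, rfl, hy⟩ := (diagGraph_adj_proj_left_iff N L a.1 v).1 h
    exact ⟨⟨y, mem_box_succ_of_zdGraph_adj (d := 2) ha' hy⟩, rfl⟩
  have hΛimg : Λ₀.map ι₂ ⊆ (Finset.univ : Finset (DiagSite N L)) := Finset.subset_univ _
  have hAimg : A₀.map ι₂ ⊆ Λ₀.map ι₂ := Finset.map_subset_map.2 hA₀Λ₀
  calc isingCorr (diagGraph N L) Finset.univ β 0 .free (A.image (diagProj N L))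
      = isingCorr (diagGraph N L) Finset.univ β 0 .plus (A₀.map ι₂) := by
        rw [← hA₀map₂, isingCorr_univ_plus_eq_free]
    _ ≤ isingCorr (diagGraph N L) (Λ₀.map ι₂) β 0 .plus (A₀.map ι₂) :=
        isingCorr_plus_le_of_subset (diagGraph N L) hβ le_rfl hAimg hΛimg
    _ = isingCorr Gs Λ₀ β 0 .plus A₀ := isingCorr_plus_map ι₂ hadj₂ hnb₂ β 0 A₀
    _ = isingCorr (zdGraph 2) (Λ₀.map ι₁) β 0 .plus (A₀.map ι₁) := (isingCorr_plus_map ι₁ hadj₁ hnb₁ β 0 A₀).symm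
    _ = isingCorr (zdGraph 2) (box 2 R) β 0 .plus A := by rw [hΛ₀map, hA₀map]

/-- **Diagonal torus ≤ plus box for the two-point function** (`x ≠ y` in `Λ_R`, `2R + 4 ≤ N`, `2N ≤ L`). [cite: BenettinGallavottiJonaLasinioStella1973, eq. (3.6)] -/
theorem dTwoPoint_le_isingCorr_plus_box {β : ℝ} (hβ : 0 ≤ β) {R : ℕ} (hRN : 2 * R + 4 ≤ N) (hL : 2 * N ≤ L)
    {x y : Site 2} (hx : x ∈ box 2 R) (hy : y ∈ box 2 R) (hxy : x ≠ y) :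
    dTwoPoint N L β (diagProj N L x) (diagProj N L y) ≤ isingCorr (zdGraph 2) (box 2 R) β 0 .plus {x, y} := by
  classical
  have hne : diagProj N L x ≠ diagProj N L y := fun h => hxy (diagProj_injOn_box (by omega) hL hx hy h)
  have himg : ({x, y} : Finset (Site 2)).image (diagProj N L) = {diagProj N L x, diagProj N L y} := by
    simp [Finset.image_insert, Finset.image_singleton]
  have key := isingCorr_diag_le_isingCorr_plus_box (N := N) (L := L) hβ hRN hL
    (A := {x, y}) (Finset.insert_subset hx (Finset.singleton_subset_iff.2 hy))
  rw [himg] at key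
  rw [dTwoPoint, isingTwoPoint_eq_isingCorr _ _ _ _ _ hne]
  exact key

end Ising

/-! ### Part 2. The marked anti-diagonal pair and the sandwich for `diagTorusPair` -/

section Pair

/-- The anti-diagonal lattice point `x_n = (-n, n)`. [folklore] -/
def antiDiag (n : ℕ) : Site 2 := ![-(n : ℤ), (n : ℤ)]

/-- `x_n ∈ Λ_R` for `n ≤ R`. [folklore] -/
theorem antiDiag_mem_box {n R : ℕ} (h : n ≤ R) : antiDiag n ∈ box 2 R := by
  rw [antiDiag, mem_box, Fin.forall_fin_two]
  simp only [Matrix.cons_val_zero, Matrix.cons_val_one]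
  omega

/-- `x_n ≠ 0` for `n ≠ 0`. [folklore] -/
theorem antiDiag_ne_zero {n : ℕ} (hn : n ≠ 0) : antiDiag n ≠ 0 := by
  intro h
  have h1 := congr_fun h 1
  simp only [antiDiag, Matrix.cons_val_one, Matrix.cons_val_zero, Pi.zero_apply, Nat.cast_eq_zero] at h1
  exact hn h1

variable {N L : ℕ} [NeZero N] [NeZero L]

omit [NeZero N] [NeZero L] in
/-- The projection of the origin is the marked site `(0, 0)`. [folklore] -/
theorem diagProj_zero : diagProj N L 0 = ((0 : ZMod L), (0 : ZMod N)) := map_zero _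

omit [NeZero N] [NeZero L] in
/-- The projection of `x_n = (-n, n)` is the marked site `(0, n)` of layer `0`. [folklore] -/
theorem diagProj_antiDiag (n : ℕ) : diagProj N L (antiDiag n) = ((0 : ZMod L), ((n : ℕ) : ZMod N)) := by
  ext
  · rw [diagProj_apply_fst, antiDiag]; simp
  · rw [diagProj_apply_snd, antiDiag]; simp

/-- **`diagTorusPair` is the two-point function between the images of `0` and `x_n`.** [folklore] -/
theorem diagTorusPair_eq_dTwoPoint (β : ℝ) (n : ℕ) :
    diagTorusPair β N L n = dTwoPoint N L β (diagProj N L 0) (diagProj N L (antiDiag n)) := by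
  have hN0 : 0 < N := Nat.pos_of_ne_zero (NeZero.ne N)
  have hL0 : 0 < L := Nat.pos_of_ne_zero (NeZero.ne L)
  rw [diagTorusPair, dif_pos ⟨hN0, hL0⟩, dTwoPoint, diagProj_zero, diagProj_antiDiag]

/-- **BGJS (3.6), first inequality, for the diagonal torus**: for `β ≥ 0`, `1 ≤ n ≤ R`,
`2R + 4 ≤ N`, `2N ≤ L`: `⟨σ_0σ_{x_n}⟩^∅_{Λ_R} ≤ ⟨σσ⟩_{𝕋_{N,L}}`. [cite: BenettinGallavottiJonaLasinioStella1973, eq. (3.6)] -/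
theorem isingCorr_free_box_le_diagTorusPair {β : ℝ} (hβ : 0 ≤ β) {n R : ℕ} (hn : 1 ≤ n) (hnR : n ≤ R)
    (hRN : 2 * R + 4 ≤ N) (hL : 2 * N ≤ L) :
    isingCorr (zdGraph 2) (box 2 R) β 0 .free {0, antiDiag n} ≤ diagTorusPair β N L n := by
  have hx0 : (0 : Site 2) ≠ antiDiag n := (antiDiag_ne_zero (by omega)).symm
  rw [diagTorusPair_eq_dTwoPoint, ← isingTwoPoint_eq_isingCorr _ _ _ _ _ hx0]
  exact isingTwoPoint_free_box_le_dTwoPoint hβ (by omega) hL (zero_mem_box 2 R) (antiDiag_mem_box hnR)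

/-- **BGJS (3.6), second inequality, for the diagonal torus**: `⟨σσ⟩_{𝕋_{N,L}} ≤ ⟨σ_0σ_{x_n}⟩⁺_{Λ_R}`. [cite: BenettinGallavottiJonaLasinioStella1973, eq. (3.6)] -/
theorem diagTorusPair_le_isingCorr_plus_box {β : ℝ} (hβ : 0 ≤ β) {n R : ℕ} (hn : 1 ≤ n) (hnR : n ≤ R)
    (hRN : 2 * R + 4 ≤ N) (hL : 2 * N ≤ L) :
    diagTorusPair β N L n ≤ isingCorr (zdGraph 2) (box 2 R) β 0 .plus {0, antiDiag n} := by
  have hx0 : (0 : Site 2) ≠ antiDiag n := (antiDiag_ne_zero (by omega)).symm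
  rw [diagTorusPair_eq_dTwoPoint]
  exact dTwoPoint_le_isingCorr_plus_box hβ hRN hL (zero_mem_box 2 R) (antiDiag_mem_box hnR) hx0

end Pair

/-! ### Part 3. The squeeze: cylinder values converge to the plus-state correlation -/

section Squeeze

/-- **BGJS (3.1)/(3.7) for the diagonal direction: where the free and plus two-point functions of
`ℤ²` agree at `x_n = (-n, n)`, the diagonal cylinder values converge to them.** For `β ≥ 0`,
`n ≥ 1`, and any numbers `c_N` such that, for all large `N`, `⟨σσ⟩_{𝕋_{N,2NM'}} → c_N` as
`M' → ∞` (the limit along the torus; by the transfer matrix these are ground-state expectations,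
`DiagonalTorus.tendsto_diagTorusPair`): if `⟨σ_0σ_{x_n}⟩^∅_β = ⟨σ_0σ_{x_n}⟩⁺_β` then
`c_N → ⟨σ_0σ_{x_n}⟩⁺_β` as `N → ∞`. Proof: (3.6) pins `c_N` between the free and plus correlations
of `Λ_R` for `N ≥ 2R + 4`, and both box sequences converge to the common value. [cite: BenettinGallavottiJonaLasinioStella1973, §3, eqs. (3.1), (3.6), (3.7)] -/
theorem tendsto_cyl_of_twoPointFree_eq_twoPointPlus {β : ℝ} (hβ : 0 ≤ β) {n : ℕ} (hn : 1 ≤ n) {c : ℕ → ℝ}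
    {N₀ : ℕ} (hin : ∀ N : ℕ, N₀ ≤ N → Tendsto (fun M' : ℕ => diagTorusPair β N (2 * (N * M')) n) atTop (𝓝 (c N)))
    (heq : twoPointFree 2 β (antiDiag n) = twoPointPlus 2 β (antiDiag n)) :
    Tendsto c atTop (𝓝 (twoPointPlus 2 β (antiDiag n))) := by
  have hx0 : antiDiag n ≠ 0 := antiDiag_ne_zero (by omega)
  have hfree : Tendsto (fun R : ℕ => isingCorr (zdGraph 2) (box 2 R) β 0 .free {0, antiDiag n}) atTop
      (𝓝 (twoPointPlus 2 β (antiDiag n))) := by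
    rw [← heq, twoPointFree_eq_freeCorr β hx0]
    exact hasBoxLimit_isingCorr_free_holds hβ le_rfl {0, antiDiag n}
  have hplus : Tendsto (fun R : ℕ => isingCorr (zdGraph 2) (box 2 R) β 0 .plus {0, antiDiag n}) atTop
      (𝓝 (twoPointPlus 2 β (antiDiag n))) := by
    rw [twoPointPlus_eq_plusCorr β hx0]
    exact hasBoxLimit_isingCorr_plus_holds hβ le_rfl {0, antiDiag n}
  -- the finite-volume sandwich along the torus subsequence, for `N ≥ 2R + 4`, `M' ≥ 1`
  have hsand : ∀ R : ℕ, n ≤ R → ∀ N : ℕ, 2 * R + 4 ≤ N → N₀ ≤ N →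
      isingCorr (zdGraph 2) (box 2 R) β 0 .free {0, antiDiag n} ≤ c N ∧
        c N ≤ isingCorr (zdGraph 2) (box 2 R) β 0 .plus {0, antiDiag n} := by
    intro R hnR N hRN hN₀
    haveI : NeZero N := ⟨by omega⟩
    constructor
    · refine ge_of_tendsto (hin N hN₀) ?_
      filter_upwards [eventually_ge_atTop 1] with M' hM'
      haveI : NeZero (2 * (N * M')) := ⟨(Nat.mul_pos two_pos (Nat.mul_pos (by omega) hM')).ne'⟩
      exact isingCorr_free_box_le_diagTorusPair hβ hn hnR hRN (by nlinarith)
    · refine le_of_tendsto (hin N hN₀) ?_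
      filter_upwards [eventually_ge_atTop 1] with M' hM'
      haveI : NeZero (2 * (N * M')) := ⟨(Nat.mul_pos two_pos (Nat.mul_pos (by omega) hM')).ne'⟩
      exact diagTorusPair_le_isingCorr_plus_box hβ hn hnR hRN (by nlinarith)
  rw [tendsto_order]
  constructor
  · intro b hb
    obtain ⟨R, hRb, hRn⟩ := ((hfree.eventually (lt_mem_nhds hb)).and (eventually_ge_atTop n)).exists
    filter_upwards [eventually_ge_atTop (2 * R + 4), eventually_ge_atTop N₀] with N hN hN'
    exact hRb.trans_le (hsand R hRn N hN hN').1
  · intro b hb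
    obtain ⟨R, hRb, hRn⟩ := ((hplus.eventually (gt_mem_nhds hb)).and (eventually_ge_atTop n)).exists
    filter_upwards [eventually_ge_atTop (2 * R + 4), eventually_ge_atTop N₀] with N hN hN'
    exact (hsand R hRn N hN hN').2.trans_lt hRb

end Squeeze

end Literature.Probability.LatticeModels
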